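import Summits.RiemannHypothesis.RiemannHypothesis.Theorems.Splittings.LinearRayTwoPoint
import Summits.RiemannHypothesis.RiemannHypothesis.Theorems.UniversalFactorMediumHighWin1
import Summits.RiemannHypothesis.RiemannHypothesis.Theorems.UniversalFactorMediumHighWin2
import HarnessLib

/-!
# RiemannHypothesis / UniversalFactor support — Lehmer-window GLUE for the linear-factor ray (RH-free)

Cell rh-split, seat (dbn, neg) gen 2 (file `HOME/rh-split-dbn-neg/LinearRayLehmerGlue.lean`, sha16
aa30ffb229fbc4b0), filed by rh-split-typer-2 g2 per lead rulings 19:28Z/19:47Z («UniversalFactor support home,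
beside `UniversalFactorMediumKernelNoGo`»).  It imports the LANDED modules `Theorems.Splittings.LinearRayRh` /
`Theorems.Splittings.LinearRayTwoPoint` (p463777 / p463925) and the high-window certificates of the medium-window
no-go engine (`…UniversalFactorMediumHighWin1/2`, imported directly to stay outside the theses cone).  Zero definitions.  The three theorems INHERIT the tree's
`UniversalFactor.hiWin1_check` / `hiWin2_check` `native_decide` axioms (through `UniversalFactor.stub_highWindow1/2`);
nothing else (typer-2 g2 H1 replay 19:46Z: rc 0 / 0 warnings / 0 sorry; `#print axioms not_linearRay_on_window` =
[propext, Classical.choice, Quot.sound, hiWin1_check/hiWin2_check native_decide]).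
* `lehmer_signs` — at `x₀ = 2·lehmerT0 = 14010.16`: `Re H_0(x₀) < 0` and the forward average `Q_a(x₀) > 0`
  for every `a ∈ [3/2, 32]` (two of the four numbers of the two-point certificate, already certified);
* `not_linearRay_of_lehmerWindowData` — the scale-free TARGET data at slope `a` refute the ray at `a`;
* `not_linearRay_on_window` — data on an `a`-box `⊂ [3/2, 32]` clear the box.
Matrix booking: cell target T14 (dbn-neg g2): refute the LINEAR-FACTOR RAY residual of
`Literature/Barriers/RiemannHypothesis/NewmanConjecture.lean` on a window by RH-FREE certificates; this file is the
typed interface of the numerical TARGET `LehmerWindowData` (not supplied here).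
HONEST LABEL: the ray is RH-strengthening (`riemannHypothesis_of_exists_linearRay`); refuting it is RH-free
bookkeeping; nothing here bears on the truth of RH.
-/

set_option linter.dupNamespace false

noncomputable section

open Complex Filter Topology MeasureTheory Set
open Literature.NumberTheory.LFunctions Literature.Analysis.Complex
open Literature.Barriers.RiemannHypothesis (linearFactorH linearFactorH_eq_deBruijnHDiv_add_deriv)
open Summit.RiemannHypothesis.RiemannHypothesis.Theorems

namespace Summit.RiemannHypothesis.RiemannHypothesis.Theorems.UniversalFactorLinearRayLehmerWindow

open Summit.RiemannHypothesis.RiemannHypothesis.Theorems.Splittings.LinearRayTwoPoint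

/-! ## What the tree already certifies at Lehmer's pair (two of the four facts) -/

/-- At `x' = 2·t₀`, `t₀ = 7005.08` (Lehmer), for every `a ∈ [3/2, 32]`: `Re H_0(x') < 0` and
`0 < Q_a(x')` — re-read from the medium-window no-go engine (`stub_highWindow`).  The two missing
facts for the linear-ray certificate are QUANTITATIVE: a lower bound `q₀ ≤ Q_a(x')` and a dip
bound `−M ≤ Re H_0` on `[x' − L, x']` with `L·M < e^{−aL} q₀` (plus `0 < Re H_0(x' − L)`). -/
theorem lehmer_signs {a : ℝ} (ha : a ∈ Icc (3 / 2 : ℝ) 32) :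
    (deBruijnH 0 ((2 * UniversalFactor.lehmerT0 : ℝ) : ℂ)).re < 0
      ∧ 0 < (∫ y in Ioi (0 : ℝ), deBruijnH 0 (((2 * UniversalFactor.lehmerT0 : ℝ) : ℂ) + y) * (Real.exp (-(a * y)) : ℂ)).re := by
  by_cases h4 : a ≤ 4
  · obtain ⟨hH, -, hQ⟩ := UniversalFactor.stub_highWindow1 a ha.1 h4
    exact ⟨hH, hQ⟩
  · obtain ⟨hH, -, hQ⟩ := UniversalFactor.stub_highWindow2 a (not_le.1 h4).le ha.2
    exact ⟨hH, hQ⟩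

/-! ## The typed numerical TARGET (scale-free Lehmer-window data, written out) -/

/-! **TARGET (Lehmer-window data at slope `a`, the `∃ κ q M L, …` hypothesis below)** (for the splitting matrix; computational, interval engine):
scale-free dip data at Lehmer's pair `x₀ = 2·7005.08`: a common unevaluated scale `κ > 0`, a window
length `0 ≤ L ≤ x₀`, and rationals `q, M ≥ 0` with `0 < Re H_0(x₀ − L)`, `κ q ≤ Q_a(x₀)`,
`−κ M ≤ Re H_0` on `[x₀ − L, x₀]`, and the margin `L·M < e^{−aL}·q`.  Design numerics (double
precision, Riemann–Siegel/Euler–Maclaurin, NOT certified): `L = 0.06`, `M̂ = 0.0039` (dip depth) and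
`q̂ = Q̂_a(x₀) ∈ {0.674 (a=1.5), 0.149 (3), 0.038 (5), 0.0048 (10), 0.0010 (16), 0.00045 (20)}` in local
`Z`-units give the margin for `a ≲ 16` and fail from `a ≈ 20` on. -/

/-- **Glue for the target:** Lehmer-window data at slope `a ∈ [3/2, 32]` refutes the linear ray at `a`
(the fourth fact, `Re H_0(x₀) < 0`, is the tree's `stub_highWindow`). -/
theorem not_linearRay_of_lehmerWindowData {a : ℝ} (ha : a ∈ Icc (3 / 2 : ℝ) 32)
    (h : (∃ κ q M L : ℝ, 0 < κ ∧ 0 ≤ L ∧ L ≤ 2 * UniversalFactor.lehmerT0 ∧ 0 ≤ M ∧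
      0 < (deBruijnH 0 ((2 * UniversalFactor.lehmerT0 - L : ℝ) : ℂ)).re ∧
      κ * q ≤ (∫ y in Ioi (0 : ℝ), deBruijnH 0 (((2 * UniversalFactor.lehmerT0 : ℝ) : ℂ) + y)
        * (Real.exp (-(a * y)) : ℂ)).re ∧
      (∀ r ∈ Icc (2 * UniversalFactor.lehmerT0 - L) (2 * UniversalFactor.lehmerT0),
        -(κ * M) ≤ (deBruijnH 0 r).re) ∧
      L * M < Real.exp (-(a * L)) * q)) : ¬ HasOnlyRealZeros (linearFactorH a) := by
  obtain ⟨κ, q, M, L, hκ, hL0, hLx, hM0, hHx, hq, hM, hmargin⟩ := h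
  have ha0 : 0 < a := lt_of_lt_of_le (by norm_num) ha.1
  have hHx' := (lehmer_signs ha).1
  have hL : 2 * UniversalFactor.lehmerT0 - (2 * UniversalFactor.lehmerT0 - L) = L := by ring
  refine not_linearRay_certificate_scaled (x := 2 * UniversalFactor.lehmerT0 - L)
    (x' := 2 * UniversalFactor.lehmerT0) ha0 (by linarith) (by linarith) hκ hHx hHx' hq hM0 hM ?_
  rw [hL]
  exact hmargin

/-- Hence a window statement of the splitting-matrix shape. -/
theorem not_linearRay_on_window {a₁ a₂ : ℝ} (h₁ : (3 / 2 : ℝ) ≤ a₁) (h₂ : a₂ ≤ 32)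
    (hdata : ∀ a ∈ Icc a₁ a₂, (∃ κ q M L : ℝ, 0 < κ ∧ 0 ≤ L ∧ L ≤ 2 * UniversalFactor.lehmerT0 ∧ 0 ≤ M ∧
      0 < (deBruijnH 0 ((2 * UniversalFactor.lehmerT0 - L : ℝ) : ℂ)).re ∧
      κ * q ≤ (∫ y in Ioi (0 : ℝ), deBruijnH 0 (((2 * UniversalFactor.lehmerT0 : ℝ) : ℂ) + y)
        * (Real.exp (-(a * y)) : ℂ)).re ∧
      (∀ r ∈ Icc (2 * UniversalFactor.lehmerT0 - L) (2 * UniversalFactor.lehmerT0),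
        -(κ * M) ≤ (deBruijnH 0 r).re) ∧
      L * M < Real.exp (-(a * L)) * q)) : ∀ a ∈ Icc a₁ a₂, ¬ HasOnlyRealZeros (linearFactorH a) :=
  fun a ha ↦ not_linearRay_of_lehmerWindowData ⟨h₁.trans ha.1, ha.2.trans h₂⟩ (hdata a ha)

end Summit.RiemannHypothesis.RiemannHypothesis.Theorems.UniversalFactorLinearRayLehmerWindow

end
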